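import Summits.QuantumAdvantage.QuantumAdvantage.Theorems.RankDialC

/-!
# RankDial (D) — part 4/4: STRICTNESS of the rank grade and the CEILING of the law

TARGET BY NAME (cell decomp-qadv, RESIDUAL MODE): item stmt-QuantumAdvantage-23109
`Summit.QuantumAdvantage.QuantumAdvantage.Theses.OddPrimeWalk.ManyReadersSqrtOdd` (=: T), reached through rung R5 =
`AdviceFreeQNC0.WalkHardFLinSel p` (`T → ∀ p ≥ 5, R5 p`, tree `JLinPeel`).  These files SUPPORT the item (`--supports`); they do not close it.

§3ter `rankOne_manyReaders`: for every `r` there are `LinSel` strategies with a cut-free window of rank `1` read by `> r` cuts (every cut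
outside the window tests «total weight ≡ 0 mod p»: `sharedForm`/`sharedRhs`/`sharedY`), so `WindowRankLinSel` is STRICTLY above g24's
`WindowFewLinSel`.  §5 the ceiling: the BLOCK SKETCH (`blockPhi`: `d = m` blocks of `t ≤ p−1` coordinates, `Φ_k = 𝟙_(block k)`) determines
`|v|` exactly (`block_wt`), hence `exactRankBound_tight` (`ExactRankBound` is tight at `ℓ = (p−1)·d`) and **`not_equiRank_block :
2 ≤ p → ¬ EquiRank p (ℓ ↦ ℓ/(p−1))`** (a level set of `G = [Σ_k x_k ≡ 0 mod 3]` is a whole residue class), `not_equiRank_three :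
¬ EquiRank 3 (ℓ ↦ 1)`, and the sandwich `rank_dial_sandwich` (`EquiRankLin p ∧ ¬ EquiRank p (ℓ ↦ ℓ/(p−1))`).  The block sketch is
Olson's extremal zero-sum-free sequence `(e_1^(p−1), …, e_d^(p−1))` of `ℤ_p^d` (Davenport constant `D(ℤ_p^d) = d(p−1)+1`).
-/

set_option linter.dupNamespace false
set_option autoImplicit false

noncomputable section
open Classical

namespace Summit.QuantumAdvantage.QuantumAdvantage.Theorems.RankDial

open Finset
open Summit.QuantumAdvantage.AdviceFreeQNC0

/-! ### §3ter The rank grade is STRICTLY coarser than readership: rank 1, arbitrarily many readers -/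

section Strict
variable (p : ℕ) [Fact p.Prime]

/-- the «everybody tests the window weight mod p» strategy: every cut outside the window `[L, L+ℓ)` fires iff the
total weight is `≡ 0 (mod p)`; interior cuts are silent (the unsatisfiable test `0 = 1`). -/
def sharedForm (L ℓ R : ℕ) (g : Fin (L + ℓ + R + 1)) (_i : Fin (L + ℓ + R)) : ZMod p :=
  if g.val ≤ L ∨ L + ℓ ≤ g.val then 1 else 0

/-- Right-hand side of the shared-form strategy: `0` for the cuts at positions `≤ L` or `≥ L+ℓ`, `1` for the window cuts. -/
def sharedRhs (L ℓ R : ℕ) (g : Fin (L + ℓ + R + 1)) : ZMod p :=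
  if g.val ≤ L ∨ L + ℓ ≤ g.val then 0 else 1

/-- The shared-form strategy: every cut tests `sharedForm · u = sharedRhs` (all cuts outside the window test «total weight ≡ 0 mod p»). -/
def sharedY (L ℓ R : ℕ) (g : Fin (L + ℓ + R + 1)) (u : Fin (L + ℓ + R) → Bool) : Bool :=
  decide ((∑ i, if u i then sharedForm p L ℓ R g i else 0) = sharedRhs p L ℓ R g)

/-- The shared-form strategy is a linear-test strategy. -/
theorem sharedY_linSel (L ℓ R : ℕ) : LinSel p (sharedY p L ℓ R) :=
  fun g => ⟨sharedForm p L ℓ R g, sharedRhs p L ℓ R g, fun _ => rfl⟩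

/-- The shared-form strategy never fires a cut strictly inside the window (`CutFree`). -/
theorem sharedY_cutFree (L ℓ R : ℕ) : CutFree (sharedY p L ℓ R) L ℓ := by
  intro g h1 h2 u
  have hc : ¬ (g.val ≤ L ∨ L + ℓ ≤ g.val) := by omega
  unfold sharedY sharedForm sharedRhs
  simp only [if_neg hc, ite_self, Finset.sum_const_zero, decide_eq_false_iff_not]
  exact zero_ne_one

/-- rank ONE: every selector factors through the single form `v ↦ Σ_j v_j` (mod `p`) of the window content. -/
theorem sharedY_rankLE_one (L ℓ R : ℕ) : RankLE p (sharedY p L ℓ R) 1 := by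
  refine ⟨1, le_rfl, fun _ _ => 1, fun g a b => ?_⟩
  by_cases hc : g.val ≤ L ∨ L + ℓ ≤ g.val
  · refine ⟨fun x => decide (x 0 = rhoW (sharedForm p L ℓ R) (sharedRhs p L ℓ R) a b g), fun v => ?_⟩
    rw [linSel_glue3 (sharedY p L ℓ R) (sharedForm p L ℓ R) (sharedRhs p L ℓ R) (fun _ _ => rfl) g a v b]
    unfold lamW sharedForm
    simp only [if_pos hc]
  · refine ⟨fun _ => false, fun v => ?_⟩
    exact sharedY_cutFree p L ℓ R g (by omega) (by omega) _

/-- … yet every cut left of the window READS it (so `#readers ≥ L + 1`, unbounded at fixed `ℓ`). -/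
theorem sharedY_reads (L ℓ R : ℕ) (hℓ : 1 ≤ ℓ) (g : Fin (L + ℓ + R + 1)) (hg : g.val ≤ L) :
    Reads (sharedY p L ℓ R) g := by
  have hc : g.val ≤ L ∨ L + ℓ ≤ g.val := Or.inl hg
  refine ⟨fun _ => false, fun _ => false, fun _ => false, fun j => decide (j = ⟨0, hℓ⟩), ?_⟩
  rw [linSel_glue3 (sharedY p L ℓ R) (sharedForm p L ℓ R) (sharedRhs p L ℓ R) (fun _ _ => rfl),
    linSel_glue3 (sharedY p L ℓ R) (sharedForm p L ℓ R) (sharedRhs p L ℓ R) (fun _ _ => rfl)]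
  unfold lamW rhoW sharedForm sharedRhs
  simp [if_pos hc]

/-- Every cut at a position `≤ L` reads the window of the shared-form strategy (for `ℓ ≥ 1`), so it has `≥ L+1` readers. -/
theorem card_readers_sharedY (L ℓ R : ℕ) (hℓ : 1 ≤ ℓ) : L + 1 ≤ (readers (sharedY p L ℓ R)).card := by
  have hsub : (univ : Finset (Fin (L + 1))).map (Fin.castLEEmb (by omega : L + 1 ≤ L + ℓ + R + 1)) ⊆
      readers (sharedY p L ℓ R) := by
    intro g hg
    rw [Finset.mem_map] at hg
    obtain ⟨i, _, rfl⟩ := hg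
    unfold readers
    rw [Finset.mem_filter]
    refine ⟨Finset.mem_univ _, sharedY_reads p L ℓ R hℓ _ ?_⟩
    have hi := i.isLt
    simp only [Fin.castLEEmb_apply, Fin.val_castLE]
    omega
  calc L + 1 = ((univ : Finset (Fin (L + 1))).map (Fin.castLEEmb (by omega : L + 1 ≤ L + ℓ + R + 1))).card := by
        rw [Finset.card_map, Finset.card_univ, Fintype.card_fin]
    _ ≤ (readers (sharedY p L ℓ R)).card := Finset.card_le_card hsub

/-- **STRICTNESS of the grade**: for every `r` there are linear-test, cut-free-window strategies of window RANK `1`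
with MORE than `r` readers — the rank grade `RankLE (ℓ/E)` covers strategies g24's readership grade
`#readers ≤ ℓ/E` does not (at every fixed window length `ℓ ≥ 1`). -/
theorem rankOne_manyReaders (ℓ R r : ℕ) (hℓ : 1 ≤ ℓ) :
    ∃ (L : ℕ) (y : Fin (L + ℓ + R + 1) → (Fin (L + ℓ + R) → Bool) → Bool),
      LinSel p y ∧ CutFree y L ℓ ∧ RankLE p y 1 ∧ r < (readers y).card :=
  ⟨r, sharedY p r ℓ R, sharedY_linSel p r ℓ R, sharedY_cutFree p r ℓ R, sharedY_rankLE_one p r ℓ R,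
    Nat.lt_of_lt_of_le (Nat.lt_succ_self r) (card_readers_sharedY p r ℓ R hℓ)⟩

end Strict

/-! ### §5 CEILING PROVED: the law fails at rank `ℓ/(p−1)` (block sketches compute `|v|`) -/

section Ceiling
variable {p : ℕ}

/-- the block sketch on `ℓ = m·t` coordinates: form `k` is the indicator of block `k` (`t` consecutive coordinates
in the product order `Fin m × Fin t ≃ Fin (m·t)`). -/
def blockPhi (p m t : ℕ) (k : Fin m) (j : Fin (m * t)) : ZMod p :=
  if (finProdFinEquiv.symm j).1 = k then 1 else 0

/-- the number of `true` coordinates of `v` in block `k` -/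
def blockCount {m t : ℕ} (v : Fin (m * t) → Bool) (k : Fin m) : ℕ :=
  (univ.filter fun i : Fin t => v (finProdFinEquiv (k, i)) = true).card

/-- A block count is at most the block length `t`. -/
theorem blockCount_le {m t : ℕ} (v : Fin (m * t) → Bool) (k : Fin m) : blockCount v k ≤ t := by
  unfold blockCount
  calc (univ.filter fun i : Fin t => v (finProdFinEquiv (k, i)) = true).card
      ≤ (univ : Finset (Fin t)).card := Finset.card_le_card (Finset.filter_subset _ _)
    _ = t := by rw [Finset.card_univ, Fintype.card_fin]

/-- form `k` of the block sketch counts block `k`: `(Φv)_k = #(v ∩ block k)` in `ℤ/p` -/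
theorem sketch_blockPhi {m t : ℕ} (v : Fin (m * t) → Bool) (k : Fin m) :
    (∑ j, if v j then blockPhi p m t k j else 0) = (blockCount v k : ZMod p) := by
  unfold blockPhi blockCount
  rw [← (finProdFinEquiv (m := m) (n := t)).sum_comp, Fintype.sum_prod_type]
  simp only [Equiv.symm_apply_apply]
  rw [Finset.sum_eq_single k]
  · rw [Finset.natCast_card_filter]
    refine Finset.sum_congr rfl fun i _ => ?_
    simp
  · intro k' _ hk'
    refine Finset.sum_eq_zero fun i _ => ?_
    simp [hk']
  · intro hk
    exact absurd (Finset.mem_univ k) hk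

/-- the blocks partition the coordinates: `Σ_k #(v ∩ block k) = |v|` -/
theorem sum_blockCount {m t : ℕ} (v : Fin (m * t) → Bool) : ∑ k, blockCount v k = wt v := by
  unfold blockCount wt
  rw [Finset.card_filter, ← (finProdFinEquiv (m := m) (n := t)).sum_comp, Fintype.sum_prod_type]
  refine Finset.sum_congr rfl fun k _ => ?_
  rw [Finset.card_filter]

/-- **Block sketches compute the weight EXACTLY**: reading the coordinates of `Φv` in `{0,…,p−1}` and adding them
gives `|v|` itself when the blocks have `t < p` coordinates. -/
theorem block_wt [NeZero p] {m t : ℕ} (ht : t < p) (v : Fin (m * t) → Bool) :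
    (∑ k : Fin m, (∑ j, if v j then blockPhi p m t k j else 0).val) = wt v := by
  have hk : ∀ k : Fin m, (∑ j, if v j then blockPhi p m t k j else 0).val = blockCount v k := by
    intro k
    rw [sketch_blockPhi, ZMod.val_natCast, Nat.mod_eq_of_lt (lt_of_le_of_lt (blockCount_le v k) ht)]
  simp_rw [hk]
  exact sum_blockCount v

/-- hence `G(x) = [Σ_k x_k ≡ 0 (mod 3)]` satisfies `G(Φv) = [|v| ≡ 0 (mod 3)]` -/
theorem block_exact [NeZero p] {m t : ℕ} (ht : t < p) (v : Fin (m * t) → Bool) :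
    decide ((∑ k : Fin m, ((fun k => ∑ j, if v j then blockPhi p m t k j else 0) k).val) % 3 = 0) =
      decide (wt v % 3 = 0) := by
  show decide ((∑ k : Fin m, (∑ j, if v j then blockPhi p m t k j else 0).val) % 3 = 0) = decide (wt v % 3 = 0)
  rw [block_wt ht v]

/-- **`ExactRankBound` is TIGHT**: at `ℓ = m·(p−1)`, `d = m`, the block sketch carries `|v| mod 3` exactly
(`p ≥ 2`; for every `m`). -/
theorem exactRankBound_tight (p : ℕ) [NeZero p] (hp : 2 ≤ p) (m : ℕ) :
    ∃ (Φ : Fin m → Fin (m * (p - 1)) → ZMod p) (G : (Fin m → ZMod p) → ℕ),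
      ∀ v : Fin (m * (p - 1)) → Bool, G (fun k => ∑ j, if v j then Φ k j else 0) = wt v % 3 :=
  ⟨blockPhi p m (p - 1), fun x => (∑ k, (x k).val) % 3, fun v => by
    show (∑ k : Fin m, (∑ j, if v j then blockPhi p m (p - 1) k j else 0).val) % 3 = wt v % 3
    rw [block_wt (by omega) v]⟩

/-- **CEILING: `EquiRank p (ℓ ↦ ℓ/(p−1))` is FALSE** for every `p ≥ 2`.  At `ℓ = m(p−1)`, `d = m`, the block sketch
and `G = [Σ_k x_k ≡ 0 (3)]` have the level set `{|v| ≡ 0 (3)}` itself, of size `N ≥ (2^ℓ − 2)/3 > 2^ℓ/16`, while the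
law would give `16N ≤ 2^ℓ`.  So the dial's threshold rank fraction satisfies `δ*(p) ≤ 1/(p−1)`. -/
theorem not_equiRank_block (p : ℕ) [NeZero p] (hp : 2 ≤ p) : ¬ EquiRank p (fun ℓ => ℓ / (p - 1)) := by
  rintro ⟨ℓ₀, h⟩
  obtain ⟨t, ht⟩ : ∃ t, p = t + 1 := ⟨p - 1, by omega⟩
  have htp : t < p := by omega
  have ht1 : 1 ≤ t := by omega
  have hpt : p - 1 = t := by omega
  -- the window: `m = ℓ₀ + 2` blocks of `t = p − 1` coordinates
  have hℓ : ℓ₀ ≤ (ℓ₀ + 2) * t := by nlinarith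
  have hd : ℓ₀ + 2 ≤ (ℓ₀ + 2) * t / (p - 1) := by
    rw [hpt, Nat.mul_div_cancel _ (by omega)]
  have hlaw := h ((ℓ₀ + 2) * t) hℓ (ℓ₀ + 2) hd (blockPhi p (ℓ₀ + 2) t)
    (fun x => decide ((∑ k : Fin (ℓ₀ + 2), (x k).val) % 3 = 0)) 0 true
  have hG : ∀ v : Fin ((ℓ₀ + 2) * t) → Bool,
      (fun x : Fin (ℓ₀ + 2) → ZMod p => decide ((∑ k : Fin (ℓ₀ + 2), (x k).val) % 3 = 0))
        (fun k => ∑ j, if v j then blockPhi p (ℓ₀ + 2) t k j else 0) = true ↔ wt v % 3 = 0 % 3 := by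
    intro v
    show decide ((∑ k : Fin (ℓ₀ + 2),
      ((fun k => ∑ j, if v j then blockPhi p (ℓ₀ + 2) t k j else 0) k).val) % 3 = 0) = true ↔ wt v % 3 = 0 % 3
    rw [block_exact htp v, decide_eq_true_iff]
  have hA : (univ.filter fun v : Fin ((ℓ₀ + 2) * t) → Bool => wt v % 3 = 0 % 3 ∧
        (fun x : Fin (ℓ₀ + 2) → ZMod p => decide ((∑ k : Fin (ℓ₀ + 2), (x k).val) % 3 = 0))
          (fun k => ∑ j, if v j then blockPhi p (ℓ₀ + 2) t k j else 0) = true)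
      = univ.filter fun v : Fin ((ℓ₀ + 2) * t) → Bool => wt v % 3 = 0 % 3 := by
    refine Finset.filter_congr fun v _ => ?_
    rw [hG v]
    exact and_self_iff
  have hB : (univ.filter fun v : Fin ((ℓ₀ + 2) * t) → Bool =>
        (fun x : Fin (ℓ₀ + 2) → ZMod p => decide ((∑ k : Fin (ℓ₀ + 2), (x k).val) % 3 = 0))
          (fun k => ∑ j, if v j then blockPhi p (ℓ₀ + 2) t k j else 0) = true)
      = univ.filter fun v : Fin ((ℓ₀ + 2) * t) → Bool => wt v % 3 = 0 % 3 := by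
    refine Finset.filter_congr fun v _ => ?_
    exact hG v
  rw [hA, hB] at hlaw
  have hclass := three_mul_card_class_add_two_ge ((ℓ₀ + 2) * t) 0
  have h4 : 4 ≤ 2 ^ ((ℓ₀ + 2) * t) := by
    calc (4 : ℕ) = 2 ^ 2 := by norm_num
      _ ≤ 2 ^ ((ℓ₀ + 2) * t) := Nat.pow_le_pow_right (by norm_num) (by nlinarith)
  omega

/-- **The coprimality is used** (`p = 3`): already ONE form (`Φ = (1,…,1)`, `Φv = |v| mod 3`) sees the weight, so
`EquiRank 3 (ℓ ↦ 1)` is false. -/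
theorem not_equiRank_three : ¬ EquiRank 3 (fun _ => 1) := by
  rintro ⟨ℓ₀, h⟩
  have hlaw := h (ℓ₀ + 2) (by omega) 1 le_rfl (fun _ _ => 1)
    (fun x => decide (x 0 = 0)) 0 true
  have hform : ∀ v : Fin (ℓ₀ + 2) → Bool, (∑ j, if v j then (fun (_ : Fin 1) (_ : Fin (ℓ₀ + 2)) => (1 : ZMod 3)) 0 j else 0)
      = (wt v : ZMod 3) := by
    intro v
    unfold wt
    rw [Finset.natCast_card_filter]
  have hG : ∀ v : Fin (ℓ₀ + 2) → Bool,
      (fun x : Fin 1 → ZMod 3 => decide (x 0 = 0))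
        (fun k => ∑ j, if v j then (fun (_ : Fin 1) (_ : Fin (ℓ₀ + 2)) => (1 : ZMod 3)) k j else 0) = true ↔
        wt v % 3 = 0 % 3 := by
    intro v
    show decide ((∑ j, if v j then (fun (_ : Fin 1) (_ : Fin (ℓ₀ + 2)) => (1 : ZMod 3)) 0 j else 0) = 0) = true ↔ _
    rw [decide_eq_true_iff, hform v, show (0 : ZMod 3) = ((0 : ℕ) : ZMod 3) by rfl, ZMod.natCast_eq_natCast_iff']
  have hA : (univ.filter fun v : Fin (ℓ₀ + 2) → Bool => wt v % 3 = 0 % 3 ∧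
        (fun x : Fin 1 → ZMod 3 => decide (x 0 = 0))
          (fun k => ∑ j, if v j then (fun (_ : Fin 1) (_ : Fin (ℓ₀ + 2)) => (1 : ZMod 3)) k j else 0) = true)
      = univ.filter fun v : Fin (ℓ₀ + 2) → Bool => wt v % 3 = 0 % 3 := by
    refine Finset.filter_congr fun v _ => ?_
    rw [hG v]
    exact and_self_iff
  have hB : (univ.filter fun v : Fin (ℓ₀ + 2) → Bool =>
        (fun x : Fin 1 → ZMod 3 => decide (x 0 = 0))
          (fun k => ∑ j, if v j then (fun (_ : Fin 1) (_ : Fin (ℓ₀ + 2)) => (1 : ZMod 3)) k j else 0) = true)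
      = univ.filter fun v : Fin (ℓ₀ + 2) → Bool => wt v % 3 = 0 % 3 := by
    refine Finset.filter_congr fun v _ => ?_
    exact hG v
  rw [hA, hB] at hlaw
  have hclass := three_mul_card_class_add_two_ge (ℓ₀ + 2) 0
  have h4 : 4 ≤ 2 ^ (ℓ₀ + 2) := by
    calc (4 : ℕ) = 2 ^ 2 := by norm_num
      _ ≤ 2 ^ (ℓ₀ + 2) := Nat.pow_le_pow_right (by norm_num) (by omega)
  omega

/-- **The sandwich** (both ends kernel theorems): for every `p ≥ 2` coprime to `3` the law HOLDS at rank `ℓ/E` for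
some `E ≥ 1` and FAILS at rank `ℓ/(p−1)`; the threshold rank fraction `δ*(p)` of the dial lies in `[1/E, 1/(p−1)]`. -/
theorem rank_dial_sandwich (p : ℕ) [NeZero p] (hp3 : p.Coprime 3) (hp : 2 ≤ p) :
    (∃ E : ℕ, 0 < E ∧ EquiRank p (fun ℓ => ℓ / E)) ∧ ¬ EquiRank p (fun ℓ => ℓ / (p - 1)) :=
  ⟨equiRank_of_coprime hp3, not_equiRank_block p hp⟩

end Ceiling

end Summit.QuantumAdvantage.QuantumAdvantage.Theorems.RankDial

end
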